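import Summits.MatrixMultiplication.MatrixMultiplication.Theorems.ObstructionDescentCountingEquations
import Literature.Computability.AlgebraicComplexity.KroneckerRank
import Literature.Computability.AlgebraicComplexity.BorderRankDirectSum

/- `set_option linter.dupNamespace false` as in the sibling kernel files (namespace `…Theorems.<FileStem>`). -/
set_option linter.dupNamespace false

/-!
# The poly-degree hull calculus: restriction, direct sum, Kronecker product (decomp-mm · lens 3 · gen 22, part 1)

Context: route `route-MatrixMultiplication-ObstructionDescent` (`ω(ℂ) = 2`), attacked leaf `E = NoPolyDegreeObstruction` (item 30889):
at the cells `n² ≤ m`, `n^τ ≤ m` (`τ > 2`, `n` large) every equation of `σ_m` of degree `≤ m^c` vanishes at the padded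
`⟨n,n,n⟩` — in the corner form of `ObstructionDescentCornerEquations.noPolyDegreeObstruction_iff_corner`: every
`h ∈ RV(σ_m)` (polynomials on `(ℂ^{n×n})^{⊗3}` vanishing on all tensors of rank `≤ m`) with `deg h ≤ m^c` vanishes at `⟨n,n,n⟩`.

This module isolates the OBJECT behind that sentence and proves its calculus.  For a format `ℂ^α ⊗ ℂ^β ⊗ ℂ^γ` put

  `hull α β γ m D := {s | every f ∈ RV α β γ m with totalDegree f ≤ D vanishes at s}`     (`§1`)

— the DEGREE-`D` HULL of `σ_m` (common zero locus of its equations of degree `≤ D`; `= σ_m` for `D → ∞`, everything for `D ≤ m` by R1).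

* `§2` SUBSTITUTION FORMS: the three linear changes of variables `f ↦ f((A⊗B⊗C)·x)`, `F ↦ F(x ⊕ t)`, `F ↦ F(x ⊠ t)` (one
  tensor slot frozen to a constant tensor) are `bind₁` along polynomials of degree `≤ 1`, so they do not raise the total
  degree (`ObstructionDescentCountingEquations.totalDegree_bind₁_le_mul` with `c = 1`).
* `§3` HEREDITY (all sorry-free, arbitrary finite formats):
  `hull_actTensor`     — `s ∈ Hull_D(σ_m) ⟹ (A⊗B⊗C)·s ∈ Hull_D(σ_m)` for ARBITRARY (rectangular, singular) matrices;
  `hull_directSum`    — `Hull_D(σ_m) ⊕ Hull_D(σ_{m'}) ⊆ Hull_D(σ_{m+m'})`;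
  `hull_kronecker`    — `Hull_D(σ_m) ⊠ Hull_D(σ_{m'}) ⊆ Hull_D(σ_{m·m'})` at the SAME degree `D`;
  `hull_precomp`, `hull_kroneckerPow` — relabelling / zeroing-out along index maps, and `s ∈ Hull_D(σ_m) ⟹ s^{⊠N} ∈ Hull_D(σ_{m^N})`.
  The proof of the last two is the two-step slice substitution: for `x` of rank `≤ m` the polynomial `y ↦ F(x ⊠ y)` is an
  equation of `σ_{m'}` of degree `≤ D` (rank is ⊠-submultiplicative, `Blaser2013_lemma58`; ⊕-subadditive,
  `tensorRank_directSumTensor_le_add`), hence vanishes at `t`; so `x ↦ F(x ⊠ t)` is an equation of `σ_m` of degree `≤ D`,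
  hence vanishes at `s`.  (For border rank — `D = ∞` — this is BCS Prop. (15.25) «R̲ is subadditive and submultiplicative»; the point is that the laws hold degree by degree.)
* `§4` the DEGREE-TRUNCATED BORDER RANK `truncRank D t := min {m | t ∈ Hull_D(σ_m)}` is restriction-monotone, ⊕-subadditive,
  ⊠-submultiplicative, `≤ rank` and `≤ D`.

The companion module `ObstructionDescentHullDescent` reads the leaf `E` through this calculus (`E ⟺ truncRank (m^c) ⟨n,n,n⟩ ≤ m`
at the cells; given `E`, every restriction and Kronecker power of `⟨n,n,n⟩`, and `⟨n²,n²,n²⟩` at `(m², m^c)`, is blind) and closes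
the route aside `PolyDegreeHullLaws`.  This module does not import the route file; nothing here concerns `ω`; sorry-free; standard
axioms only.
[cite: Blaser2013, Lemma 5.4 + Lemma 5.8; BurgisserClausenShokrollahi1997, Prop. (15.25) (pdf p. 423); LandsbergGCT2017, §8.3.2 + Prop. 8.3.4.2 (p. 226–227)]
-/

set_option autoImplicit false

noncomputable section

open scoped BigOperators

namespace Summit.MatrixMultiplication.MatrixMultiplication.Theorems.ObstructionDescentHullCalculus

open Literature.Computability.AlgebraicComplexity (tensorRank actTensor actTensor_apply kroneckerTensor kroneckerTensor_apply
  directSumTensor kroneckerPow kroneckerPow_apply Blaser2013_lemma58 tensorRank_directSumTensor_le_add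
  tensorRestrictsTo_actTensor tensorRestrictsTo_precomp tensorRank_kroneckerPow_zero_le_one)
open Summit.MatrixMultiplication.MatrixMultiplication.Theorems.ObstructionDescentTorusLaws (RV mem_RV eq_zero_of_totalDegree_le)
open Summit.MatrixMultiplication.MatrixMultiplication.Theorems.ObstructionDescentCountingEquations (totalDegree_bind₁_le_mul)

/-! ## §1 The degree-`D` hull of `σ_m` -/

section Hull

variable {α β γ : Type} [Fintype α] [Fintype β] [Fintype γ]

variable (α β γ) in
/-- The **degree-`D` hull of `σ_m`** in the format `ℂ^α ⊗ ℂ^β ⊗ ℂ^γ`: tensors at which every equation of `σ_m` of total degree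
`≤ D` vanishes. [cite: LandsbergGCT2017, §8.3.2 (p. 226)] -/
def hull (m D : ℕ) : Set (α → β → γ → ℂ) :=
  {s | ∀ f : MvPolynomial (α × β × γ) ℂ, f.totalDegree ≤ D → f ∈ RV α β γ m →
    MvPolynomial.aeval (fun p : α × β × γ => s p.1 p.2.1 p.2.2) f = 0}

variable {m m' D D' : ℕ}

/-- Membership in the hull, unfolded. [bookkeeping] -/
theorem mem_hull {s : α → β → γ → ℂ} : s ∈ hull α β γ m D ↔
    ∀ f : MvPolynomial (α × β × γ) ℂ, f.totalDegree ≤ D → f ∈ RV α β γ m →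
      MvPolynomial.aeval (fun p : α × β × γ => s p.1 p.2.1 p.2.2) f = 0 := Iff.rfl

/-- `σ_m ⊆ Hull_D(σ_m)`: tensors of rank `≤ m` lie in every hull of `σ_m`. [bookkeeping] -/
theorem mem_hull_of_tensorRank_le {s : α → β → γ → ℂ} (hs : tensorRank s ≤ m) : s ∈ hull α β γ m D :=
  fun _ _ hf => mem_RV.1 hf s hs

/-- Hulls grow with the secant index. [bookkeeping] -/
theorem hull_mono (h : m ≤ m') : hull α β γ m D ⊆ hull α β γ m' D :=
  fun _ hs f hdeg hf => hs f hdeg (mem_RV.2 fun u hu => mem_RV.1 hf u (hu.trans h))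

/-- Hulls shrink as the degree budget grows. [bookkeeping] -/
theorem hull_antitone (h : D ≤ D') : hull α β γ m D' ⊆ hull α β γ m D :=
  fun _ hs f hdeg hf => hs f (hdeg.trans h) hf

/-- Rung R1 in hull form: with degree budget `D ≤ m` the hull of `σ_m` is the whole format (equations of `σ_m` of degree `≤ m`
are `0`). [cite: LandsbergGCT2017, Prop. 8.3.4.2 (p. 227)] -/
theorem hull_eq_univ_of_le (h : D ≤ m) : hull α β γ m D = Set.univ := by
  classical
  refine Set.eq_univ_of_forall fun s f hdeg hf => ?_
  rw [eq_zero_of_totalDegree_le hf (hdeg.trans h), map_zero]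

end Hull

/-! ## §2 Substitution forms: freezing slots is linear -/

section Forms

variable {α β γ α' β' γ' : Type}

/-- A polynomial of the shape `C c * X p` has total degree `≤ 1`. [bookkeeping] -/
theorem totalDegree_C_mul_X_le {σ : Type} (c : ℂ) (p : σ) :
    (MvPolynomial.C c * MvPolynomial.X p : MvPolynomial σ ℂ).totalDegree ≤ 1 := by
  refine (MvPolynomial.totalDegree_mul _ _).trans ?_
  rw [MvPolynomial.totalDegree_C, zero_add]
  exact (MvPolynomial.totalDegree_X (R := ℂ) p).le

/-- The linear forms `x ↦ ((A⊗B⊗C)·x)_q`, as degree-`1` polynomials in the coordinates of `x`. [bookkeeping] -/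
def actForm [Fintype α] [Fintype β] [Fintype γ] (A : Matrix α' α ℂ) (B : Matrix β' β ℂ) (C : Matrix γ' γ ℂ) (q : α' × β' × γ') :
    MvPolynomial (α × β × γ) ℂ :=
  ∑ p : α × β × γ, MvPolynomial.C (A q.1 p.1 * B q.2.1 p.2.1 * C q.2.2 p.2.2) * MvPolynomial.X p

/-- The action forms have degree `≤ 1`. [bookkeeping] -/
theorem totalDegree_actForm_le [Fintype α] [Fintype β] [Fintype γ] (A : Matrix α' α ℂ) (B : Matrix β' β ℂ) (C : Matrix γ' γ ℂ) (q : α' × β' × γ') :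
    (actForm A B C q).totalDegree ≤ 1 := by
  classical
  unfold actForm
  exact (MvPolynomial.totalDegree_finsetSum _ _).trans (Finset.sup_le fun p _ => totalDegree_C_mul_X_le _ p)

/-- Substituting the action forms and evaluating at `s` = evaluating at `(A⊗B⊗C)·s`. [bookkeeping] -/
theorem aeval_bind₁_actForm [Fintype α] [Fintype β] [Fintype γ] (A : Matrix α' α ℂ) (B : Matrix β' β ℂ) (C : Matrix γ' γ ℂ) (s : α → β → γ → ℂ)
    (g : MvPolynomial (α' × β' × γ') ℂ) :
    MvPolynomial.aeval (fun p : α × β × γ => s p.1 p.2.1 p.2.2) (MvPolynomial.bind₁ (actForm A B C) g) =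
      MvPolynomial.aeval (fun q : α' × β' × γ' => actTensor A B C s q.1 q.2.1 q.2.2) g := by
  have hfun : (fun q : α' × β' × γ' =>
      MvPolynomial.aeval (fun p : α × β × γ => s p.1 p.2.1 p.2.2) (actForm A B C q)) =
      fun q : α' × β' × γ' => actTensor A B C s q.1 q.2.1 q.2.2 := by
    funext q
    simp only [actForm, map_sum, map_mul, MvPolynomial.aeval_C, MvPolynomial.aeval_X, Algebra.algebraMap_self,
      RingHom.id_apply, actTensor_apply, Fintype.sum_prod_type]
  rw [MvPolynomial.aeval_bind₁, hfun]

/-- The substitution `x ↦ x ⊠ t` (right Kronecker slot frozen): the coordinate `(a,a'),(b,b'),(c,c')` becomes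
`t a' b' c' · X_{(a,b,c)}`. [bookkeeping] -/
def kronRightForm (t : α' → β' → γ' → ℂ) (q : (α × α') × (β × β') × (γ × γ')) : MvPolynomial (α × β × γ) ℂ :=
  MvPolynomial.C (t q.1.2 q.2.1.2 q.2.2.2) * MvPolynomial.X (q.1.1, q.2.1.1, q.2.2.1)

/-- The substitution `y ↦ s ⊠ y` (left Kronecker slot frozen). [bookkeeping] -/
def kronLeftForm (s : α → β → γ → ℂ) (q : (α × α') × (β × β') × (γ × γ')) : MvPolynomial (α' × β' × γ') ℂ :=
  MvPolynomial.C (s q.1.1 q.2.1.1 q.2.2.1) * MvPolynomial.X (q.1.2, q.2.1.2, q.2.2.2)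

/-- The right-Kronecker substitution forms have degree `≤ 1`. [bookkeeping] -/
theorem totalDegree_kronRightForm_le (t : α' → β' → γ' → ℂ) (q : (α × α') × (β × β') × (γ × γ')) :
    (kronRightForm (α := α) (β := β) (γ := γ) t q).totalDegree ≤ 1 :=
  totalDegree_C_mul_X_le _ _

/-- The left-Kronecker substitution forms have degree `≤ 1`. [bookkeeping] -/
theorem totalDegree_kronLeftForm_le (s : α → β → γ → ℂ) (q : (α × α') × (β × β') × (γ × γ')) :
    (kronLeftForm (α' := α') (β' := β') (γ' := γ') s q).totalDegree ≤ 1 :=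
  totalDegree_C_mul_X_le _ _

/-- Substituting `x ↦ x ⊠ t` and evaluating at `s` = evaluating at `s ⊠ t`. [bookkeeping] -/
theorem aeval_bind₁_kronRightForm (s : α → β → γ → ℂ) (t : α' → β' → γ' → ℂ)
    (F : MvPolynomial ((α × α') × (β × β') × (γ × γ')) ℂ) :
    MvPolynomial.aeval (fun p : α × β × γ => s p.1 p.2.1 p.2.2) (MvPolynomial.bind₁ (kronRightForm t) F) =
      MvPolynomial.aeval (fun q : (α × α') × (β × β') × (γ × γ') => kroneckerTensor s t q.1 q.2.1 q.2.2) F := by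
  have hfun : (fun q : (α × α') × (β × β') × (γ × γ') =>
      MvPolynomial.aeval (fun p : α × β × γ => s p.1 p.2.1 p.2.2) (kronRightForm t q)) =
      fun q => kroneckerTensor s t q.1 q.2.1 q.2.2 := by
    funext q
    simp only [kronRightForm, map_mul, MvPolynomial.aeval_C, MvPolynomial.aeval_X, Algebra.algebraMap_self,
      RingHom.id_apply, kroneckerTensor_apply, mul_comm]
  rw [MvPolynomial.aeval_bind₁, hfun]

/-- Substituting `y ↦ s ⊠ y` and evaluating at `t` = evaluating at `s ⊠ t`. [bookkeeping] -/
theorem aeval_bind₁_kronLeftForm (s : α → β → γ → ℂ) (t : α' → β' → γ' → ℂ)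
    (F : MvPolynomial ((α × α') × (β × β') × (γ × γ')) ℂ) :
    MvPolynomial.aeval (fun p : α' × β' × γ' => t p.1 p.2.1 p.2.2) (MvPolynomial.bind₁ (kronLeftForm s) F) =
      MvPolynomial.aeval (fun q : (α × α') × (β × β') × (γ × γ') => kroneckerTensor s t q.1 q.2.1 q.2.2) F := by
  have hfun : (fun q : (α × α') × (β × β') × (γ × γ') =>
      MvPolynomial.aeval (fun p : α' × β' × γ' => t p.1 p.2.1 p.2.2) (kronLeftForm s q)) =
      fun q => kroneckerTensor s t q.1 q.2.1 q.2.2 := by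
    funext q
    simp only [kronLeftForm, map_mul, MvPolynomial.aeval_C, MvPolynomial.aeval_X, Algebra.algebraMap_self,
      RingHom.id_apply, kroneckerTensor_apply]
  rw [MvPolynomial.aeval_bind₁, hfun]

/-- The substitution `x ↦ x ⊕ t` (right summand frozen): diagonal-block coordinates of the first block become variables,
those of the second block the constants `t`, mixed coordinates `0`. [bookkeeping] -/
def sumRightForm (t : α' → β' → γ' → ℂ) : (α ⊕ α') × (β ⊕ β') × (γ ⊕ γ') → MvPolynomial (α × β × γ) ℂ
  | (Sum.inl a, Sum.inl b, Sum.inl c) => MvPolynomial.X (a, b, c)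
  | (Sum.inr a, Sum.inr b, Sum.inr c) => MvPolynomial.C (t a b c)
  | _ => 0

/-- The substitution `y ↦ s ⊕ y` (left summand frozen). [bookkeeping] -/
def sumLeftForm (s : α → β → γ → ℂ) : (α ⊕ α') × (β ⊕ β') × (γ ⊕ γ') → MvPolynomial (α' × β' × γ') ℂ
  | (Sum.inl a, Sum.inl b, Sum.inl c) => MvPolynomial.C (s a b c)
  | (Sum.inr a, Sum.inr b, Sum.inr c) => MvPolynomial.X (a, b, c)
  | _ => 0

/-- The right-summand substitution forms have degree `≤ 1`. [bookkeeping] -/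
theorem totalDegree_sumRightForm_le (t : α' → β' → γ' → ℂ) (q : (α ⊕ α') × (β ⊕ β') × (γ ⊕ γ')) :
    (sumRightForm (α := α) (β := β) (γ := γ) t q).totalDegree ≤ 1 := by
  obtain ⟨a | a, b | b, c | c⟩ := q <;>
    simp only [sumRightForm, MvPolynomial.totalDegree_X, MvPolynomial.totalDegree_C, MvPolynomial.totalDegree_zero,
      le_refl, zero_le]

/-- The left-summand substitution forms have degree `≤ 1`. [bookkeeping] -/
theorem totalDegree_sumLeftForm_le (s : α → β → γ → ℂ) (q : (α ⊕ α') × (β ⊕ β') × (γ ⊕ γ')) :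
    (sumLeftForm (α' := α') (β' := β') (γ' := γ') s q).totalDegree ≤ 1 := by
  obtain ⟨a | a, b | b, c | c⟩ := q <;>
    simp only [sumLeftForm, MvPolynomial.totalDegree_X, MvPolynomial.totalDegree_C, MvPolynomial.totalDegree_zero,
      le_refl, zero_le]

/-- Substituting `x ↦ x ⊕ t` and evaluating at `s` = evaluating at `s ⊕ t`. [bookkeeping] -/
theorem aeval_bind₁_sumRightForm (s : α → β → γ → ℂ) (t : α' → β' → γ' → ℂ)
    (F : MvPolynomial ((α ⊕ α') × (β ⊕ β') × (γ ⊕ γ')) ℂ) :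
    MvPolynomial.aeval (fun p : α × β × γ => s p.1 p.2.1 p.2.2) (MvPolynomial.bind₁ (sumRightForm t) F) =
      MvPolynomial.aeval (fun q : (α ⊕ α') × (β ⊕ β') × (γ ⊕ γ') => directSumTensor s t q.1 q.2.1 q.2.2) F := by
  have hfun : (fun q : (α ⊕ α') × (β ⊕ β') × (γ ⊕ γ') =>
      MvPolynomial.aeval (fun p : α × β × γ => s p.1 p.2.1 p.2.2) (sumRightForm t q)) =
      fun q => directSumTensor s t q.1 q.2.1 q.2.2 := by
    funext q
    obtain ⟨a | a, b | b, c | c⟩ := q <;>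
      simp [sumRightForm, directSumTensor]
  rw [MvPolynomial.aeval_bind₁, hfun]

/-- Substituting `y ↦ s ⊕ y` and evaluating at `t` = evaluating at `s ⊕ t`. [bookkeeping] -/
theorem aeval_bind₁_sumLeftForm (s : α → β → γ → ℂ) (t : α' → β' → γ' → ℂ)
    (F : MvPolynomial ((α ⊕ α') × (β ⊕ β') × (γ ⊕ γ')) ℂ) :
    MvPolynomial.aeval (fun p : α' × β' × γ' => t p.1 p.2.1 p.2.2) (MvPolynomial.bind₁ (sumLeftForm s) F) =
      MvPolynomial.aeval (fun q : (α ⊕ α') × (β ⊕ β') × (γ ⊕ γ') => directSumTensor s t q.1 q.2.1 q.2.2) F := by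
  have hfun : (fun q : (α ⊕ α') × (β ⊕ β') × (γ ⊕ γ') =>
      MvPolynomial.aeval (fun p : α' × β' × γ' => t p.1 p.2.1 p.2.2) (sumLeftForm s q)) =
      fun q => directSumTensor s t q.1 q.2.1 q.2.2 := by
    funext q
    obtain ⟨a | a, b | b, c | c⟩ := q <;>
      simp [sumLeftForm, directSumTensor]
  rw [MvPolynomial.aeval_bind₁, hfun]

end Forms

/-! ## §3 Heredity: restriction, direct sum, Kronecker product -/

section Heredity

variable {α β γ α' β' γ' : Type} [Fintype α] [Fintype β] [Fintype γ] [Fintype α'] [Fintype β'] [Fintype γ']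
variable {m m' D : ℕ}

/-- Pulling an equation of `σ_m` back along the action `(A⊗B⊗C)·` gives an equation of `σ_m` of no larger degree (rank is
monotone under restriction). [cite: Blaser2013, Lemma 5.4] -/
theorem bind₁_actForm_mem_RV (A : Matrix α' α ℂ) (B : Matrix β' β ℂ) (C : Matrix γ' γ ℂ)
    {g : MvPolynomial (α' × β' × γ') ℂ} (hg : g ∈ RV α' β' γ' m) :
    MvPolynomial.bind₁ (actForm A B C) g ∈ RV α β γ m := by
  refine mem_RV.2 fun u hu => ?_
  rw [aeval_bind₁_actForm]
  exact mem_RV.1 hg _ (((tensorRestrictsTo_actTensor A B C u).tensorRank_le).trans hu)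

/-- **Restriction heredity.** The degree-`D` hull of `σ_m` is closed under `(A⊗B⊗C)·` for ARBITRARY matrices between formats
(in particular under restriction, zeroing-out and relabelling). [cite: Blaser2013, Lemma 5.4; LandsbergGCT2017, §8.3.2] -/
theorem hull_actTensor {s : α → β → γ → ℂ} (hs : s ∈ hull α β γ m D) (A : Matrix α' α ℂ) (B : Matrix β' β ℂ)
    (C : Matrix γ' γ ℂ) : actTensor A B C s ∈ hull α' β' γ' m D := by
  intro g hdeg hg
  rw [← aeval_bind₁_actForm]
  exact hs _ (((totalDegree_bind₁_le_mul _ 1 (totalDegree_actForm_le A B C) g).trans_eq (one_mul _)).trans hdeg)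
    (bind₁_actForm_mem_RV A B C hg)

/-- **Direct-sum heredity.** `Hull_D(σ_m) ⊕ Hull_D(σ_{m'}) ⊆ Hull_D(σ_{m+m'})` — degree by degree.
[cite: BurgisserClausenShokrollahi1997, Prop. (15.25) (pdf p. 423: border rank is subadditive)] -/
theorem hull_directSum {s : α → β → γ → ℂ} {t : α' → β' → γ' → ℂ} (hs : s ∈ hull α β γ m D)
    (ht : t ∈ hull α' β' γ' m' D) :
    directSumTensor s t ∈ hull (α ⊕ α') (β ⊕ β') (γ ⊕ γ') (m + m') D := by
  intro F hdeg hF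
  -- Step A: for `x` of rank `≤ m`, `F(x ⊕ t) = 0` (freeze `x`, an equation of `σ_{m'}` of degree `≤ D`, evaluate at `t`).
  have stepA : ∀ x : α → β → γ → ℂ, tensorRank x ≤ m →
      MvPolynomial.aeval (fun q : (α ⊕ α') × (β ⊕ β') × (γ ⊕ γ') => directSumTensor x t q.1 q.2.1 q.2.2) F = 0 := by
    intro x hx
    rw [← aeval_bind₁_sumLeftForm]
    refine ht _ (((totalDegree_bind₁_le_mul _ 1 (totalDegree_sumLeftForm_le x) F).trans_eq (one_mul _)).trans hdeg)
      (mem_RV.2 fun y hy => ?_)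
    rw [aeval_bind₁_sumLeftForm]
    exact mem_RV.1 hF _ ((tensorRank_directSumTensor_le_add x y).trans (Nat.add_le_add hx hy))
  -- Step B: freeze `t`; by Step A this is an equation of `σ_m` of degree `≤ D`; evaluate at `s`.
  rw [← aeval_bind₁_sumRightForm]
  refine hs _ (((totalDegree_bind₁_le_mul _ 1 (totalDegree_sumRightForm_le t) F).trans_eq (one_mul _)).trans hdeg)
    (mem_RV.2 fun x hx => ?_)
  rw [aeval_bind₁_sumRightForm]
  exact stepA x hx

/-- **Kronecker heredity.** `Hull_D(σ_m) ⊠ Hull_D(σ_{m'}) ⊆ Hull_D(σ_{m·m'})` — at the SAME degree `D`.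
[cite: Blaser2013, Lemma 5.8; BurgisserClausenShokrollahi1997, Prop. (15.25) (pdf p. 423: border rank is submultiplicative)] -/
theorem hull_kronecker {s : α → β → γ → ℂ} {t : α' → β' → γ' → ℂ} (hs : s ∈ hull α β γ m D)
    (ht : t ∈ hull α' β' γ' m' D) :
    kroneckerTensor s t ∈ hull (α × α') (β × β') (γ × γ') (m * m') D := by
  intro F hdeg hF
  have stepA : ∀ x : α → β → γ → ℂ, tensorRank x ≤ m →
      MvPolynomial.aeval (fun q : (α × α') × (β × β') × (γ × γ') => kroneckerTensor x t q.1 q.2.1 q.2.2) F = 0 := by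
    intro x hx
    rw [← aeval_bind₁_kronLeftForm]
    refine ht _ (((totalDegree_bind₁_le_mul _ 1 (totalDegree_kronLeftForm_le x) F).trans_eq (one_mul _)).trans hdeg)
      (mem_RV.2 fun y hy => ?_)
    rw [aeval_bind₁_kronLeftForm]
    exact mem_RV.1 hF _ ((Blaser2013_lemma58 x y).trans (Nat.mul_le_mul hx hy))
  rw [← aeval_bind₁_kronRightForm]
  refine hs _ (((totalDegree_bind₁_le_mul _ 1 (totalDegree_kronRightForm_le t) F).trans_eq (one_mul _)).trans hdeg)
    (mem_RV.2 fun x hx => ?_)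
  rw [aeval_bind₁_kronRightForm]
  exact stepA x hx

end Heredity

section Powers

variable {α β γ α' β' γ' : Type} [Fintype α] [Fintype β] [Fintype γ] [Fintype α'] [Fintype β'] [Fintype γ']
variable {m D : ℕ}

/-- **Relabelling heredity.** Precomposition along arbitrary index maps (relabelling, duplication, zeroing-out by restriction
to a sub-format) preserves the hull. [cite: Blaser2013, Def. 7.2] -/
theorem hull_precomp {s : α → β → γ → ℂ} (hs : s ∈ hull α β γ m D) (e : α' → α) (f : β' → β) (g : γ' → γ) :
    (fun a b c => s (e a) (f b) (g c)) ∈ hull α' β' γ' m D := by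
  classical
  intro F hdeg hF
  have hev : ∀ u : α → β → γ → ℂ, MvPolynomial.aeval (fun p : α × β × γ => u p.1 p.2.1 p.2.2)
      (MvPolynomial.rename (fun q : α' × β' × γ' => (e q.1, f q.2.1, g q.2.2)) F) =
      MvPolynomial.aeval (fun q : α' × β' × γ' => u (e q.1) (f q.2.1) (g q.2.2)) F := fun u => by
    rw [MvPolynomial.aeval_rename]
    rfl
  rw [← hev]
  refine hs _ ((MvPolynomial.totalDegree_rename_le _ _).trans hdeg) (mem_RV.2 fun u hu => ?_)
  rw [hev]
  exact mem_RV.1 hF (fun a b c => u (e a) (f b) (g c)) (((tensorRestrictsTo_precomp u e f g).tensorRank_le).trans hu)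

/-- **Kronecker-power heredity.** `s ∈ Hull_D(σ_m) ⟹ s^{⊠N} ∈ Hull_D(σ_{m^N})`, same degree `D`.
[cite: Blaser2013, Lemma 5.8] -/
theorem hull_kroneckerPow {s : α → β → γ → ℂ} (hs : s ∈ hull α β γ m D) (N : ℕ) :
    kroneckerPow s N ∈ hull (Fin N → α) (Fin N → β) (Fin N → γ) (m ^ N) D := by
  induction N with
  | zero =>
    exact mem_hull_of_tensorRank_le ((tensorRank_kroneckerPow_zero_le_one s).trans (pow_zero m).symm.le)
  | succ N ih =>
    have key : kroneckerPow s (N + 1) = fun a b c =>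
        kroneckerTensor s (kroneckerPow s N) (a 0, Fin.tail a) (b 0, Fin.tail b) (c 0, Fin.tail c) := by
      funext a b c
      simp only [kroneckerPow_apply, kroneckerTensor_apply, Fin.prod_univ_succ]
      rfl
    rw [key, pow_succ']
    exact hull_precomp (hull_kronecker hs ih) _ _ _

end Powers

/-! ## §4 The degree-truncated border rank -/

section TruncRank

variable {α β γ α' β' γ' : Type} [Fintype α] [Fintype β] [Fintype γ] [Fintype α'] [Fintype β'] [Fintype γ']

/-- The **degree-`D` truncated border rank** `R_D(t) := min {m | t ∈ Hull_D(σ_m)}`: the least secant index whose equations of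
degree `≤ D` all vanish at `t` (non-decreasing in `D`, `≤ D`, `≤ rank`, and equal to the border rank for `D` large).
[cite: LandsbergGCT2017, §8.3.2 (p. 226)] -/
def truncRank (D : ℕ) (t : α → β → γ → ℂ) : ℕ :=
  sInf {m | t ∈ hull α β γ m D}

variable {D : ℕ}

/-- The minimum in `truncRank` is attained: `t ∈ Hull_D(σ_{R_D(t)})` (the index set contains `rank t`). [bookkeeping] -/
theorem truncRank_spec (t : α → β → γ → ℂ) : t ∈ hull α β γ (truncRank D t) D :=
  Nat.sInf_mem (s := {m | t ∈ hull α β γ m D}) ⟨tensorRank t, mem_hull_of_tensorRank_le le_rfl⟩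

/-- `t ∈ Hull_D(σ_m) ⟹ R_D(t) ≤ m`. [bookkeeping] -/
theorem truncRank_le_of_mem_hull {t : α → β → γ → ℂ} {m : ℕ} (h : t ∈ hull α β γ m D) : truncRank D t ≤ m :=
  Nat.sInf_le h

/-- `t ∈ Hull_D(σ_m) ⟺ R_D(t) ≤ m`. [bookkeeping] -/
theorem mem_hull_iff_truncRank_le {t : α → β → γ → ℂ} {m : ℕ} : t ∈ hull α β γ m D ↔ truncRank D t ≤ m :=
  ⟨truncRank_le_of_mem_hull, fun h => hull_mono h (truncRank_spec t)⟩

/-- `R_D ≤ R` (indeed `≤` border rank). [bookkeeping] -/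
theorem truncRank_le_tensorRank (t : α → β → γ → ℂ) : truncRank D t ≤ tensorRank t :=
  truncRank_le_of_mem_hull (mem_hull_of_tensorRank_le le_rfl)

/-- `R_D ≤ D`: with budget `D` the equations of `σ_D` are already invisible (rung R1). [cite: LandsbergGCT2017, Prop. 8.3.4.2] -/
theorem truncRank_le_degree (t : α → β → γ → ℂ) : truncRank D t ≤ D :=
  truncRank_le_of_mem_hull (by rw [hull_eq_univ_of_le le_rfl]; exact Set.mem_univ t)

/-- `R_D` is monotone under restriction by arbitrary matrices. [cite: Blaser2013, Lemma 5.4] -/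
theorem truncRank_actTensor_le (A : Matrix α' α ℂ) (B : Matrix β' β ℂ) (C : Matrix γ' γ ℂ) (t : α → β → γ → ℂ) :
    truncRank D (actTensor A B C t) ≤ truncRank D t :=
  truncRank_le_of_mem_hull (hull_actTensor (truncRank_spec t) A B C)

/-- `R_D` is ⊕-subadditive. [cite: BurgisserClausenShokrollahi1997, Prop. (15.25) (pdf p. 423)] -/
theorem truncRank_directSum_le (s : α → β → γ → ℂ) (t : α' → β' → γ' → ℂ) :
    truncRank D (directSumTensor s t) ≤ truncRank D s + truncRank D t :=
  truncRank_le_of_mem_hull (hull_directSum (truncRank_spec s) (truncRank_spec t))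

/-- `R_D` is ⊠-submultiplicative (same `D` on both factors and the product). [cite: Blaser2013, Lemma 5.8] -/
theorem truncRank_kronecker_le (s : α → β → γ → ℂ) (t : α' → β' → γ' → ℂ) :
    truncRank D (kroneckerTensor s t) ≤ truncRank D s * truncRank D t :=
  truncRank_le_of_mem_hull (hull_kronecker (truncRank_spec s) (truncRank_spec t))

end TruncRank

end Summit.MatrixMultiplication.MatrixMultiplication.Theorems.ObstructionDescentHullCalculus

end
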